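/- Copyright: the b2b-balaban cell (near-miss cell 7), T⁴-continuum fan-out, lineage t4-ne7b-formalise-leaf-04 (NE7b
ROUND-2 crew, leaf prover 04).  Released under the licence of the surrounding project. -/
import Summits.QuantumFields.BalabanUV.T4Continuum.Support.B16RelPosOp

/-!
# (1.72) per level WITH THE INNER HISTORY SUMS EXPOSED — re-open object (α) of row NE7b, `SCOPE-alpha.md` v2.2 §5 row M1
(operator side, head of the chain M1 → M2 → M4∕M5), part 2 of 2; crux-team module of lineage `t4-ne7b-formalise-leaf-04`
gen 23 under the coordinator ruling «YM redirect» (crux node NE7b, route R-P1 «EXTRACTION ∕ GENEALOGY») — PRE-POSITIONING ONLY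

Summits-side support leaf of the T⁴-continuum cell (rung (B)+1 on a FINITE torus only; NOT infinite volume, NOT the
mass gap, NOT Clay; NOT a proof of NE7b — the cell's OWN estimate, NOT PRINTED, NOT PROVED).  [folklore] algebra over
part 1 (`B16RelPosOp`) and gen 4's certified `B16Cor3Ops`∕`B16Cor3Scales` (GAPS C-pv06-4); nothing printed asserted, no
`def … : Prop` fact of Bałaban's, no cite-tagged hypothesis, zero `sorry`.  (1.71)∕(1.72) pp. 378–379 and (1.73) p. 380 of
B16 = [Balaban1989LargeFieldII] (UNDER AUDIT) are quoted as CONTEXT (renders `…/1989-cmp122-large-field-II-p024∕p025∕p026-x2.png`,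
journal page = render + 354, re-read as images by this seat).

WHY.  Gen 4's `Repr172` keeps every HISTORY SUM of (1.72) p. 379 INSIDE its summand: *"(Σ_{{Ω^c_j,Z_j}} 𝐓″_k(Z_k))"* is ONE
operation, `Π_i 𝐓_k(Y_i)` — each `𝐓′_k(Y_i)` being the SUM (1.71) p. 378 *"Σ_{{Ω^c_j∩X, Z_j∩X}, r}"* over the old admissible
sequences restricted to the component — ONE operation, the curly bracket *"{Σ_{n≥0} Σ_{{X_1,…,X_n}} Π_j 𝐓′_k(X_j) exp Σ_Y V(Y,U_k)}"*
ONE function: enough for (2.50)∕(0.1), NOT for (α), whose junction M4 must read the GENEALOGY of the large-field components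
off the index of a term — the index must BE the history.  Here the inner sums are finite sums over EXPLICIT index sets (the
skeleton `HIndex`: per outer summand `a`, histories `HZs a` of the new region `Z_k`, sub-history choices `HYs a` inside the
second-class components `{Y_i}`, curly summands `HCs a` = (n, the first-class components `{X_j}`, their sub-histories)),
the operations are RELATIVE ADDITIVE POSITIVE OPERATIONS (part 1), and — p. 379: *"Notice that the terms V(Y,U_k) depend on
the sequence {Ω^c_j, Z_j} restricted to the components of Z contained in Y, and that the sum in the definition (1.71) acts
also on the last exponential in (1.72)"* — the last exponential `exp Σ_Y V(Y,U_k)` is indexed by the FULL choice `(h, ℓ, c)`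
(data `Vs a h ℓ c`, real at `(U,0)` p. 379∕380).  The summand `term a` is the nested triple sum; THE EXPANSION
`term a = Σ_{(h,ℓ,c) ∈ LIdx a} eterm a (h,ℓ,c)` is proved (additivity); U1∕L1 hold PER ELEMENTARY TERM (`abs_eterm_le`: a
history choice weighs at most the PRODUCT OF ITS PER-OPERATION FACTORS; `eterm_nonneg`); and (2.50)∕(0.1) one run, one
step follows through `B16Cor3Scales.uvIneq_of_structure_classes` (`uvIneq_of_repr172R`) — gen 4's conclusion VERBATIM from
data that genuine integrals can inhabit.  «(1.72) holds for the density» stays the DISPLAYED per-level hypothesis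
`∀ V, ρ V = Σ_a term a V` (never a definition, never asserted).

NOT HERE (honest).  The identification of `HZ`∕`HL`∕`HC` with the level-indexed admissible sequences along the run and the
full-history sigma type (M2); integrals against an observable (M2∕M4); any factor (1.79)–(1.89) (hypotheses with locators,
as in gen 4); (1.98) (the bracket's exponentiation).  BY-NAME EFFECT ON THE WALL: NONE (`reprA∕reprB`∕`realised` need
M2 + M4).  HONEST DEPENDENCY (cell): continuum YM on T⁴ ⇐ BetaPertH ∧ nine spine estimates (0/9 proved); BetaPertH ⇐
(D1) ∧ (D4) ∧ CAP+tail; G-an2-4 gates asym, D1 and NE2/3/4.  This file changes none of it.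
-/

open Finset
open Literature.MathematicalPhysics.QuantumFieldTheory.Balaban1983to89
open Literature.MathematicalPhysics.QuantumFieldTheory.Balaban1983to89.B16Cor3Ops

namespace Summit.QuantumFields.BalabanUV.T4Continuum.B16HistoryIndexedRepr

/-! ## 1. The index skeleton -/

/-- **THE INDEX SKELETON of (1.72) p. 379 with its inner history sums EXPOSED**: gen 4's outer data (`Adm` [Fintype] = the
double sum `Σ_{Z_k} Σ_{{Y_i}}`, `Zc a` = components of the new region `Z_k`, `Ys a` = `{Y_i}`, `index_inj`, the all-small
summand `allSmall` with `Z_k = ∅`, `m = 0`) and, NEW, the explicit finite index sets of the three inner sums — `HZs a`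
(histories `{Ω^c_j,Z_j}` of the new region), `HYs a` (sub-history choices of (1.71) inside the `Y_i`), `HCs a` (the curly
bracket's summands); singleton history sets `hz₀`∕`hl₀` for the all-small summand.  Pure indexing data, kept apart from the
operations so that a source-dressed family and the cell's two runs can share it (the END's `T K` is source-free). [folklore] -/
structure HIndex (Dom : Type*) where
  Adm : Type
  [finAdm : Fintype Adm]
  Zc : Adm → Finset Dom
  Ys : Adm → Finset Dom
  index_inj : ∀ a b, Zc a = Zc b → Ys a = Ys b → a = b
  HZ : Type
  HL : Type
  HC : Type
  HZs : Adm → Finset HZ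
  HYs : Adm → Finset HL
  HCs : Adm → Finset HC
  allSmall : Adm
  Zc_allSmall : Zc allSmall = ∅
  Ys_allSmall : Ys allSmall = ∅
  hz₀ : HZ
  HZs_allSmall : HZs allSmall = {hz₀}
  hl₀ : HL
  HYs_allSmall : HYs allSmall = {hl₀}

namespace HIndex

variable {Dom : Type*}

/-- The outer index set is finite; exposes `finAdm`. [folklore] -/
instance instFintypeAdm (I : HIndex Dom) : Fintype I.Adm := I.finAdm

/-- The level's FULL index set for `a`: (history of `Z_k`) × (sub-history choice in `{Y_i}`) × (curly summand). [folklore] -/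
def LIdx (I : HIndex Dom) (a : I.Adm) : Finset (I.HZ × I.HL × I.HC) :=
  I.HZs a ×ˢ (I.HYs a ×ˢ I.HCs a)

/-- The tagged family `(components of Z_k) ⊎ {Y_i}` of the summand `a` (gen 4's `Repr172.fam` on the skeleton). [folklore] -/
def fam (I : HIndex Dom) (a : I.Adm) : Finset (Fin 2 × Dom) :=
  ((I.Zc a).disjSum (I.Ys a)).map (Repr172.tagEmb Dom)

/-- The family map is injective (`index_inj`; gen 4's `fam_injective`). [folklore] -/
theorem fam_injective (I : HIndex Dom) : Function.Injective I.fam := by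
  intro a b h
  obtain ⟨hZ, hY⟩ := Repr172.disjSum_inj (Finset.map_injective (Repr172.tagEmb Dom) h)
  exact I.index_inj a b hZ hY

end HIndex

/-! ## 2. The operations of (1.72) over a skeleton, relative to a good class -/

/-- **THE OPERATIONS of (1.72) p. 379 over the skeleton `I`, relative to the good class `𝒢`**: the characteristic functions
`χ a` (in `[0,1]` downstream), the completed action `A′_k`, `𝐓″_k(Z_k)` per history (`TZh a h`), the composite
`Π_i 𝐓_k(Y_i)` ((1.102) p. 390) per sub-history choice (`TYl a ℓ`), the curly composite `Π_j 𝐓′_k(X_j)` per curly summand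
(`TC a c`), and the last exponent `Σ_Y V(Y,U_k)` for the FULL choice (`Vs a h ℓ c`; p. 379: the (1.71)-sums act also on the
last exponential); the displayed goodness of `χ a`, `exp A′_k`, `exp Σ_Y V`; the all-small identities `𝐓″_k(∅) = 1`, empty
`Y`-product `= 1`.  A READING of the displayed formula as data — NOTHING of (1.72) is asserted. [folklore] -/
structure Repr172R {C : Type*} (𝒢 : GoodClass C) {Dom : Type*} (I : HIndex Dom) where
  χ : I.Adm → C → ℝ
  A' : C → ℝ
  TZh : I.Adm → I.HZ → RelLinPosOp 𝒢
  TYl : I.Adm → I.HL → RelLinPosOp 𝒢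
  TC : I.Adm → I.HC → RelLinPosOp 𝒢
  Vs : I.Adm → I.HZ → I.HL → I.HC → C → ℝ
  χ_good : ∀ a, 𝒢.Gd (χ a)
  expA_good : 𝒢.Gd (fun V => Real.exp (A' V))
  E_good : ∀ a h l c, 𝒢.Gd (fun U => Real.exp (Vs a h l c U))
  TZh_allSmall : ∀ F, (TZh I.allSmall I.hz₀).T F = F
  TYl_allSmall : ∀ F, (TYl I.allSmall I.hl₀).T F = F

namespace Repr172R

variable {C : Type*} {𝒢 : GoodClass C} {Dom : Type*} {I : HIndex Dom} (R : Repr172R 𝒢 I)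

/-- The last exponential `exp Σ_Y V(Y,U_k)` of the full choice `(h, ℓ, c)`. [folklore] -/
noncomputable def E (a : I.Adm) (h : I.HZ) (l : I.HL) (c : I.HC) : C → ℝ := fun U => Real.exp (R.Vs a h l c U)

/-- The curly bracket under the choices `(h, ℓ)`: `Σ_c (Π_j 𝐓′_k(X_j))_c exp Σ_Y V_{h,ℓ,c}`. [folklore] -/
noncomputable def curly (a : I.Adm) (h : I.HZ) (l : I.HL) : C → ℝ :=
  fun U => ∑ c ∈ I.HCs a, (R.TC a c).T (R.E a h l c) U

/-- What `𝐓″_{k,h}` acts on: `exp A′_k · Σ_ℓ (Π_i 𝐓_k(Y_i))_ℓ {⋯}_{h,ℓ}`. [folklore] -/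
noncomputable def inner (a : I.Adm) (h : I.HZ) : C → ℝ :=
  fun W => Real.exp (R.A' W) * ∑ l ∈ I.HYs a, (R.TYl a l).T (R.curly a h l) W

/-- **THE SUMMAND `a` OF (1.72)** as printed, inner sums nested: `χ_a · Σ_h 𝐓″_{k,h}[exp A′_k · Σ_ℓ (Π_i𝐓_k(Y_i))_ℓ {Σ_c ⋯}]`.
«(1.72) holds for the density `ρ`» is the displayed hypothesis `∀ V, ρ V = Σ_a term a V`. [folklore] -/
noncomputable def term (a : I.Adm) (V : C) : ℝ := R.χ a V * ∑ h ∈ I.HZs a, (R.TZh a h).T (R.inner a h) V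

/-- What `𝐓″_{k,h}` acts on for ONE choice `(ℓ, c)`: `exp A′_k · (Π_i 𝐓_k(Y_i))_ℓ [(Π_j 𝐓′_k(X_j))_c exp Σ_Y V_{h,ℓ,c}]`. [folklore] -/
noncomputable def innerH (a : I.Adm) (ι : I.HZ × I.HL × I.HC) : C → ℝ :=
  fun W => Real.exp (R.A' W) * (R.TYl a ι.2.1).T ((R.TC a ι.2.2).T (R.E a ι.1 ι.2.1 ι.2.2)) W

/-- **THE ELEMENTARY TERM** of the full choice `ι = (h, ℓ, c)` at the configuration `V`: the weight of one history choice.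
[folklore] -/
noncomputable def eterm (a : I.Adm) (ι : I.HZ × I.HL × I.HC) (V : C) : ℝ :=
  R.χ a V * (R.TZh a ι.1).T (R.innerH a ι) V

/-- The curly bracket is good. [folklore] -/
theorem curly_good (a : I.Adm) (h : I.HZ) (l : I.HL) : 𝒢.Gd (R.curly a h l) :=
  𝒢.sum (I.HCs a) _ fun c _ => (R.TC a c).map_good (R.E_good a h l c)

/-- `inner a h` is good. [folklore] -/
theorem inner_good (a : I.Adm) (h : I.HZ) : 𝒢.Gd (R.inner a h) :=
  𝒢.mul R.expA_good (𝒢.sum (I.HYs a) _ fun l _ => (R.TYl a l).map_good (R.curly_good a h l))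

/-- `innerH a ι` is good. [folklore] -/
theorem innerH_good (a : I.Adm) (ι : I.HZ × I.HL × I.HC) : 𝒢.Gd (R.innerH a ι) :=
  𝒢.mul R.expA_good ((R.TYl a ι.2.1).map_good ((R.TC a ι.2.2).map_good (R.E_good a ι.1 ι.2.1 ι.2.2)))

/-! ## 3. The expansion -/

/-- `inner a h = Σ_{(ℓ,c)} innerH a (h,ℓ,c)` (additivity of each `TYl a ℓ` on the good class). [folklore] -/
theorem inner_eq_sum (a : I.Adm) (h : I.HZ) (W : C) :
    R.inner a h W = ∑ p ∈ I.HYs a ×ˢ I.HCs a, R.innerH a (h, p) W := by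
  rw [Finset.sum_product]
  show Real.exp (R.A' W) * ∑ l ∈ I.HYs a, (R.TYl a l).T (fun U => ∑ c ∈ I.HCs a, (R.TC a c).T (R.E a h l c) U) W = _
  rw [Finset.mul_sum]
  refine Finset.sum_congr rfl fun l _ => ?_
  rw [(R.TYl a l).map_sum (I.HCs a) (fun c => (R.TC a c).T (R.E a h l c))
    (fun c _ => (R.TC a c).map_good (R.E_good a h l c)) W, Finset.mul_sum]
  rfl

/-- **THE EXPANSION THEOREM**: the summand `a` of (1.72) IS the finite sum of its elementary terms over the level's full
index set — `term a V = Σ_{ι ∈ LIdx a} eterm a ι V` (additivity of `TZh a h` pulls the inner double sum out). [folklore] -/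
theorem term_eq_sum_eterm (a : I.Adm) (V : C) : R.term a V = ∑ ι ∈ I.LIdx a, R.eterm a ι V := by
  unfold HIndex.LIdx term
  rw [Finset.sum_product, Finset.mul_sum]
  refine Finset.sum_congr rfl fun h _ => ?_
  have e : R.inner a h = fun W => ∑ p ∈ I.HYs a ×ˢ I.HCs a, R.innerH a (h, p) W := funext (R.inner_eq_sum a h)
  rw [e, (R.TZh a h).map_sum _ _ (fun p _ => R.innerH_good a (h, p)), Finset.mul_sum]
  rfl

/-- **(1.72) HOLDS, history-indexed form**: the displayed per-level hypothesis «`ρ(V) = Σ_a term a V`» is EQUIVALENT to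
`ρ(V) = Σ_a Σ_{ι ∈ LIdx a} eterm a ι V` — the density as a finite sum of history-choice weights. [folklore] -/
theorem holds_iff_sum_eterm (ρ : C → ℝ) :
    (∀ V, ρ V = ∑ a : I.Adm, R.term a V) ↔ ∀ V, ρ V = ∑ a : I.Adm, ∑ ι ∈ I.LIdx a, R.eterm a ι V := by
  simp only [term_eq_sum_eterm]

/-! ## 4. U1 ∕ L1 per elementary term -/

/-- **L1 per elementary term**: `eterm ≥ 0` from `χ_a ≥ 0` alone — positivity on the class (p. 380), `exp A′_k > 0`,
`exp Σ_Y V > 0` (real at `(U,0)`, p. 379∕380; NO displayed hypothesis on the bracket at this granularity). [folklore] -/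
theorem eterm_nonneg (a : I.Adm) (ι : I.HZ × I.HL × I.HC) (hχ : ∀ V, 0 ≤ R.χ a V) (V : C) : 0 ≤ R.eterm a ι V := by
  have g := R.E_good a ι.1 ι.2.1 ι.2.2
  have h1 : ∀ U, 0 ≤ (R.TC a ι.2.2).T (R.E a ι.1 ι.2.1 ι.2.2) U := fun U =>
    (R.TC a ι.2.2).apply_nonneg g (fun _ => (Real.exp_pos _).le) U
  have h2 : ∀ W, 0 ≤ R.innerH a ι W := fun W =>
    mul_nonneg (Real.exp_pos _).le ((R.TYl a ι.2.1).apply_nonneg ((R.TC a ι.2.2).map_good g) h1 W)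
  exact mul_nonneg (hχ V) ((R.TZh a ι.1).apply_nonneg (R.innerH_good a ι) h2 V)

/-- **U1 per elementary term — A HISTORY CHOICE WEIGHS AT MOST THE PRODUCT OF ITS PER-OPERATION FACTORS**: `0 ≤ χ_a ≤ 1`,
uniform weights `𝐓″_{k,h}1 ≤ wZ`, `(Π_i 𝐓_k(Y_i))_ℓ 1 ≤ wY`, `(Π_j 𝐓′_k(X_j))_c 1 ≤ wC` (the factor leaves (1.79)∕(1.89),
composed by `RelLinPosOp.piR_one_le`; hypotheses with gen 4's locators), `A′_k ≤ BA` (upper (2.49) [III]), `Σ_Y V ≤ BV`;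
(1.73) three times: `|eterm a (h,ℓ,c) V| ≤ wZ · e^{BA} · wY · wC · e^{BV}`. [folklore] -/
theorem abs_eterm_le (a : I.Adm) (ι : I.HZ × I.HL × I.HC) {wZ wY wC BA BV : ℝ}
    (hχ : ∀ V, 0 ≤ R.χ a V ∧ R.χ a V ≤ 1)
    (hZ : ∀ W, (R.TZh a ι.1).T (fun _ => 1) W ≤ wZ) (hY : ∀ W, (R.TYl a ι.2.1).T (fun _ => 1) W ≤ wY)
    (hC : ∀ W, (R.TC a ι.2.2).T (fun _ => 1) W ≤ wC) (hA : ∀ W, R.A' W ≤ BA) (hV : ∀ W, R.Vs a ι.1 ι.2.1 ι.2.2 W ≤ BV)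
    (V : C) : |R.eterm a ι V| ≤ wZ * (Real.exp BA * (wY * (wC * Real.exp BV))) := by
  have hwC : 0 ≤ wC := ((R.TC a ι.2.2).one_nonneg V).trans (hC V)
  have hwY : 0 ≤ wY := ((R.TYl a ι.2.1).one_nonneg V).trans (hY V)
  have gE := R.E_good a ι.1 ι.2.1 ι.2.2
  have h1 : ∀ U, |(R.TC a ι.2.2).T (R.E a ι.1 ι.2.1 ι.2.2) U| ≤ Real.exp BV * wC := fun U => by
    have hE : ∀ U', |R.E a ι.1 ι.2.1 ι.2.2 U'| ≤ Real.exp BV := fun U' => by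
      rw [abs_of_pos (show 0 < R.E a ι.1 ι.2.1 ι.2.2 U' from Real.exp_pos _)]
      exact Real.exp_le_exp.mpr (hV U')
    exact ((R.TC a ι.2.2).abs_apply_le gE hE U).trans (mul_le_mul_of_nonneg_left (hC U) (Real.exp_pos _).le)
  have hK1 : 0 ≤ Real.exp BV * wC := mul_nonneg (Real.exp_pos _).le hwC
  have h2 : ∀ W, |(R.TYl a ι.2.1).T ((R.TC a ι.2.2).T (R.E a ι.1 ι.2.1 ι.2.2)) W| ≤ Real.exp BV * wC * wY := fun W =>
    ((R.TYl a ι.2.1).abs_apply_le ((R.TC a ι.2.2).map_good gE) h1 W).trans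
      (mul_le_mul_of_nonneg_left (hY W) hK1)
  have hK2 : 0 ≤ Real.exp BV * wC * wY := mul_nonneg hK1 hwY
  have h3 : ∀ W, |R.innerH a ι W| ≤ Real.exp BA * (Real.exp BV * wC * wY) := fun W => by
    unfold innerH
    rw [abs_mul, abs_of_pos (Real.exp_pos _)]
    exact mul_le_mul (Real.exp_le_exp.mpr (hA W)) (h2 W) (abs_nonneg _) (Real.exp_pos _).le
  have hK3 : 0 ≤ Real.exp BA * (Real.exp BV * wC * wY) := mul_nonneg (Real.exp_pos _).le hK2
  have h4 : |(R.TZh a ι.1).T (R.innerH a ι) V| ≤ Real.exp BA * (Real.exp BV * wC * wY) * wZ :=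
    ((R.TZh a ι.1).abs_apply_le (R.innerH_good a ι) h3 V).trans (mul_le_mul_of_nonneg_left (hZ V) hK3)
  unfold eterm
  rw [abs_mul, abs_of_nonneg (hχ V).1]
  calc R.χ a V * |(R.TZh a ι.1).T (R.innerH a ι) V|
      ≤ 1 * (Real.exp BA * (Real.exp BV * wC * wY) * wZ) := mul_le_mul (hχ V).2 h4 (abs_nonneg _) zero_le_one
    _ = wZ * (Real.exp BA * (wY * (wC * Real.exp BV))) := by ring

/-! ## 5. (2.50)∕(0.1), one run, one step, from the history-indexed data -/

/-- **(2.50)∕(0.1), ONE RUN, ONE STEP, FROM THE HISTORY-INDEXED DATA** — `B16Cor3Scales.uvIneq_of_structure_classes` (two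
classes: components of `Z_k`, the `Y_i`) fed, as gen 4's `Repr172.uvIneq_of_repr172` is, with: (1.72) holds for `D.ρ k`
(displayed), `0 ≤ χ ≤ 1`, all-small `χ = χ_k`, PER-HISTORY factor leaves with displayed sums (`Σ_h wZ a h ≤ Π_{X∈Z_k}
e^{−c₀−κ₁d_k X}` — (1.79)∕(1.89) with p. 383's history count absorbed —, idem `wY`, `(Σ_c wC a c)·e^{BV} ≤ e^{ε′N}` uniformly
in `(h, ℓ)`), upper (2.49) `hA'up`, the all-small bracket `= exp Rre` with `|Rre| ≤ εN` ((1.98)∕(1.100), displayed), lower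
bookkeeping `hA'`, cube count `hπ`.  Conclusion VERBATIM as gen 4. [folklore] -/
theorem uvIneq_of_repr172R (D : B16.RunData) (k : ℕ) (S : LocDomainSys) {𝒢 : GoodClass (D.Cfg k)}
    {I : HIndex S.Dom} (R : Repr172R 𝒢 I)
    (G : B12TreeDecay.CubeSystem S) {Δ : ℕ} (hΔ : G.DegreeLE Δ) {c₀ : ℝ}
    (hV : G.VolumeLeaf c₀) {κ₁ : ℝ} (hκ : B12TreeDecay.kappa₀ c₀ Δ ≤ κ₁)
    (c : Fin 2 → ℝ) (πc : ℝ) (hπ : (Fintype.card G.toCubeCover.Cube : ℝ) ≤ πc * (D.numSites k : ℝ))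
    (Rre : D.Cfg k → ℝ) (E₁ ε ε' E' BV : ℝ)
    (wZ : I.Adm → I.HZ → ℝ) (wY : I.Adm → I.HL → ℝ) (wC : I.Adm → I.HC → ℝ)
    (hH : ∀ V, D.ρ k V = ∑ a : I.Adm, R.term a V)
    (hχ01 : ∀ a V, 0 ≤ R.χ a V ∧ R.χ a V ≤ 1)
    (h0χ : ∀ V, R.χ I.allSmall V = D.χ k V)
    (hZh : ∀ a, ∀ h ∈ I.HZs a, ∀ V, (R.TZh a h).T (fun _ => 1) V ≤ wZ a h)
    (hZsum : ∀ a, ∑ h ∈ I.HZs a, wZ a h ≤ ∏ X ∈ I.Zc a, Real.exp (-(c 0) - κ₁ * S.dj X))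
    (hYl : ∀ a, ∀ l ∈ I.HYs a, ∀ V, (R.TYl a l).T (fun _ => 1) V ≤ wY a l)
    (hYsum : ∀ a, ∑ l ∈ I.HYs a, wY a l ≤ ∏ Y ∈ I.Ys a, Real.exp (-(c 1) - κ₁ * S.dj Y))
    (hCc : ∀ a, ∀ c' ∈ I.HCs a, ∀ V, (R.TC a c').T (fun _ => 1) V ≤ wC a c')
    (hVs : ∀ a h l, ∀ c' ∈ I.HCs a, ∀ V, R.Vs a h l c' V ≤ BV)
    (hCsum : ∀ a, (∑ c' ∈ I.HCs a, wC a c') * Real.exp BV ≤ Real.exp (ε' * (D.numSites k : ℝ)))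
    (hA'up : ∀ V, R.A' V ≤ E' * (D.numSites k : ℝ))
    (h0c : ∀ V, R.curly I.allSmall I.hz₀ I.hl₀ V = Real.exp (Rre V))
    (hR : ∀ V, |Rre V| ≤ ε * (D.numSites k : ℝ))
    (hA' : ∀ V, D.χ k V ≠ 0 →
      -(1 / (D.flow.g k) ^ 2 * D.wilsonBG k V) - E₁ * (D.numSites k : ℝ) ≤ R.A' V) :
    ∀ V : D.Cfg k, B16.UVIneq D k V (E₁ + ε)
      (E' + ε' + πc * B12TreeDecay.K₀ c₀ Δ * ∑ i, Real.exp (-(c i))) := by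
  set N : ℝ := (D.numSites k : ℝ) with hN
  let W : Fin 2 × S.Dom → ℝ := fun t => Real.exp (-(c t.1) - κ₁ * S.dj t.2)
  let major : I.Adm → ℝ := fun a => Real.exp ((E' + ε') * N) * ∏ t ∈ I.fam a, W t
  let TD : B14Cor3.TermData D k := { Adm := I.Adm, term := R.term, major := major, allSmall := I.allSmall }
  -- the bracket, per choice `(h, ℓ)`: `0 ≤ {⋯} ≤ e^{ε′N}`
  have hcurly : ∀ a h l V, 0 ≤ R.curly a h l V ∧ R.curly a h l V ≤ Real.exp (ε' * N) := fun a h l V => by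
    refine ⟨Finset.sum_nonneg fun c' _ =>
      (R.TC a c').apply_nonneg (R.E_good a h l c') (fun _ => (Real.exp_pos _).le) V, le_trans ?_ (hCsum a)⟩
    rw [Finset.sum_mul]
    refine Finset.sum_le_sum fun c' hc' => ?_
    have hE : ∀ U, R.E a h l c' U ≤ Real.exp BV := fun U => Real.exp_le_exp.mpr (hVs a h l c' hc' U)
    calc (R.TC a c').T (R.E a h l c') V ≤ Real.exp BV * (R.TC a c').T (fun _ => 1) V :=
          (R.TC a c').apply_le_of_le (R.E_good a h l c') hE V
      _ ≤ Real.exp BV * wC a c' := mul_le_mul_of_nonneg_left (hCc a c' hc' V) (Real.exp_pos _).le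
      _ = wC a c' * Real.exp BV := mul_comm _ _
  -- `inner a h`: `|⋯| ≤ e^{E′N} · e^{ε′N} · Π_i W(1, Y_i)`, and `≥ 0`
  have hYW : ∀ a, 0 ≤ ∏ Y ∈ I.Ys a, W (1, Y) := fun a => Finset.prod_nonneg fun _ _ => (Real.exp_pos _).le
  have hinner_nn : ∀ a h W', 0 ≤ R.inner a h W' := fun a h W' =>
    mul_nonneg (Real.exp_pos _).le (Finset.sum_nonneg fun l _ =>
      (R.TYl a l).apply_nonneg (R.curly_good a h l) (fun U => (hcurly a h l U).1) W')
  have hinner : ∀ a h W', |R.inner a h W'| ≤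
      Real.exp (E' * N) * (Real.exp (ε' * N) * ∏ Y ∈ I.Ys a, W (1, Y)) := fun a h W' => by
    have hs : ∑ l ∈ I.HYs a, (R.TYl a l).T (R.curly a h l) W' ≤ Real.exp (ε' * N) * ∏ Y ∈ I.Ys a, W (1, Y) :=
      calc ∑ l ∈ I.HYs a, (R.TYl a l).T (R.curly a h l) W'
          ≤ ∑ l ∈ I.HYs a, Real.exp (ε' * N) * wY a l := Finset.sum_le_sum fun l hl =>
            ((R.TYl a l).apply_le_of_le (R.curly_good a h l) (fun U => (hcurly a h l U).2) W').trans
              (mul_le_mul_of_nonneg_left (hYl a l hl W') (Real.exp_pos _).le)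
        _ = Real.exp (ε' * N) * ∑ l ∈ I.HYs a, wY a l := by rw [Finset.mul_sum]
        _ ≤ Real.exp (ε' * N) * ∏ Y ∈ I.Ys a, W (1, Y) := mul_le_mul_of_nonneg_left (hYsum a) (Real.exp_pos _).le
    rw [abs_of_nonneg (hinner_nn a h W')]
    unfold inner
    exact mul_le_mul (Real.exp_le_exp.mpr (hA'up W')) hs
      (Finset.sum_nonneg fun l _ => (R.TYl a l).apply_nonneg (R.curly_good a h l) (fun U => (hcurly a h l U).1) W')
      (Real.exp_pos _).le
  have hK : ∀ a, 0 ≤ Real.exp (E' * N) * (Real.exp (ε' * N) * ∏ Y ∈ I.Ys a, W (1, Y)) := fun a =>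
    mul_nonneg (Real.exp_pos _).le (mul_nonneg (Real.exp_pos _).le (hYW a))
  -- U1 per term
  have hU1 : ∀ a V, R.term a V ≤ major a := fun a V => by
    have hs : ∑ h ∈ I.HZs a, (R.TZh a h).T (R.inner a h) V ≤
        (Real.exp (E' * N) * (Real.exp (ε' * N) * ∏ Y ∈ I.Ys a, W (1, Y))) * ∏ X ∈ I.Zc a, W (0, X) :=
      calc ∑ h ∈ I.HZs a, (R.TZh a h).T (R.inner a h) V
          ≤ ∑ h ∈ I.HZs a, (Real.exp (E' * N) * (Real.exp (ε' * N) * ∏ Y ∈ I.Ys a, W (1, Y))) * wZ a h :=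
            Finset.sum_le_sum fun h hh =>
              (le_abs_self _).trans (((R.TZh a h).abs_apply_le (R.inner_good a h) (hinner a h) V).trans
                (mul_le_mul_of_nonneg_left (hZh a h hh V) (hK a)))
        _ = (Real.exp (E' * N) * (Real.exp (ε' * N) * ∏ Y ∈ I.Ys a, W (1, Y))) * ∑ h ∈ I.HZs a, wZ a h := by
            rw [Finset.mul_sum]
        _ ≤ _ := mul_le_mul_of_nonneg_left (hZsum a) (hK a)
    have h4 : R.term a V ≤ 1 * ((Real.exp (E' * N) * (Real.exp (ε' * N) * ∏ Y ∈ I.Ys a, W (1, Y))) *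
        ∏ X ∈ I.Zc a, W (0, X)) := by
      unfold term
      exact mul_le_mul (hχ01 a V).2 hs (Finset.sum_nonneg fun h _ =>
        (R.TZh a h).apply_nonneg (R.inner_good a h) (hinner_nn a h) V) zero_le_one
    refine h4.trans (le_of_eq ?_)
    show _ = Real.exp ((E' + ε') * N) * ∏ t ∈ I.fam a, W t
    rw [HIndex.fam, Finset.prod_map, Finset.prod_disjSum, add_mul, Real.exp_add]
    show _ = Real.exp (E' * N) * Real.exp (ε' * N) * ((∏ X ∈ I.Zc a, W (0, X)) * ∏ Y ∈ I.Ys a, W (1, Y))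
    ring
  have hL1 : ∀ a V, 0 ≤ R.term a V := fun a V =>
    mul_nonneg (hχ01 a V).1 (Finset.sum_nonneg fun h _ =>
      (R.TZh a h).apply_nonneg (R.inner_good a h) (hinner_nn a h) V)
  have hform : ∀ V, R.term I.allSmall V = D.χ k V * Real.exp (R.A' V + Rre V) := fun V => by
    unfold term
    rw [I.HZs_allSmall, Finset.sum_singleton, R.TZh_allSmall, h0χ, Real.exp_add]
    unfold inner
    rw [I.HYs_allSmall, Finset.sum_singleton, R.TYl_allSmall, h0c]
  have hχ : ∀ V, 0 ≤ D.χ k V := fun V => by rw [← h0χ V]; exact (hχ01 I.allSmall V).1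
  exact B16Cor3Scales.uvIneq_of_structure_classes D k TD S G hΔ hV hκ c πc hπ I.fam R.A' Rre E₁ ε (E' + ε')
    hH hU1 I.fam_injective (fun a => le_rfl) hL1 hform hχ hA' hR

end Repr172R

end Summit.QuantumFields.BalabanUV.T4Continuum.B16HistoryIndexedRepr
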